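import Summits.MatrixMultiplication.OmegaCensus.DicyclicN1GeneralCosets
import Summits.MatrixMultiplication.OmegaCensus.DicyclicParityTools
import Summits.MatrixMultiplication.OmegaCensus.DicyclicSubgroupRestriction
import Mathlib.NumberTheory.LegendreSymbol.AddCharacter
import HarnessLib

/-!
# Class N1 (`(1,1),(2,2),(k−1,k+1)`) of the dicyclic-law triples is dead for EVERY quotient `A/⟨c₀⟩` of `2`-rank `≥ 3`

ω-census `pub-omega`, family (b3), seat pub-omega-group gen 13.  Framing: lottery ticket; floor = certified bounds/negative
ranges.  VALUE: kernel theorems about the group-theoretic method (TPP capacity of dihedral-like groups); NOT progress on ω.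

Gen 12 (`DicyclicN1Law.no_n1_dicyclic_law`) killed the class N1 when `B = A/⟨c₀⟩` is a `2`-group; the `2`-group entered only
through the character of `B` killing the survivors of the two-point lemma.  With `Ψ = (ψ₁,ψ₂,ψ₃) : A → V = 𝔽₂³` (killing
`c₀`, jointly onto) and the `T`-differences `e₀, e₁`:
* if `Ψe₀ ≠ 0 ≠ Ψe₁`, a vector `w` pairing to `1` with both gives `φ = ⟨w, Ψ·⟩ : A → 𝔽₂` with `φ e₀ = φ e₁ = 1`; it factors
  through `π : A → B` (`AddMonoidHom.liftOfSurjective`) and `χ = (−1)^{φ̄}` (`AddChar.zmodChar 2`) is the killing character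
  (`χ(πe₁ ∓ πe₀) = 1`, `χ(πe₁) = −1`); gen 12's chain with `hkill` (`n1_four_cosets'`) yields the four cosets and
  `psi_not_onto_of_four_cosets` the contradiction;
* if `Ψe₀ = 0` or `Ψe₁ = 0`, a non-zero `w` orthogonal to the other difference and to `Ψδ`, `δ = (t₁−t₀)−(s₁−s₀)`, makes
  `φ` constant on every coset part of `S` (a domino) and of `T` with the right cross condition, and the index-`2` restriction
  `no_dicyclic_law_of_two_small_first_second` (gen 13) ends it (`n1_restrict_aux`).

**Theorem (`no_n1_dicyclic_law_general`).** Dicyclic type, `c₀ ≠ 0`, `|A| ≡ 2 (mod 3)`, `|A| ≥ 28`, `A/⟨c₀⟩ ↠ 𝔽₂³`,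
`π : A →+ B` onto with kernel `{0, c₀}` (ANY `B`): no TPP triple with `|S₀| = |S₁| = 1`, `|T₀| = |T₁| = 2`, `|U₀| ≠ |U₁|`
attains `3|S||T||U| + 16 = 8|A|`.
-/

namespace Summit.MatrixMultiplication.OmegaCensus

open Literature.Combinatorics.Additive Finset

/-- Two non-zero vectors of `𝔽₂³` have a common vector pairing to `1` with both. [folklore] -/
theorem f2cube_exists_both (v₀ v₁ : ZMod 2 × ZMod 2 × ZMod 2) :
    v₀ = 0 ∨ v₁ = 0 ∨ ∃ w : ZMod 2 × ZMod 2 × ZMod 2, (w * v₀).1 + (w * v₀).2.1 + (w * v₀).2.2 ≠ 0 ∧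
      (w * v₁).1 + (w * v₁).2.1 + (w * v₁).2.2 ≠ 0 := by
  revert v₀ v₁; decide

section N1

variable {A : Type} [AddCommGroup A] [DecidableEq A] [Fintype A] {G : Type} [Group G] [DecidableEq G]
  {ρ τ : A → G} {c₀ : A} {B : Type} [AddCommGroup B] [DecidableEq B] [Fintype B]

omit [DecidableEq B] [Fintype B] in
/-- **The restriction branch.**  A TPP triple attaining the dicyclic law with `S₀ = {s₀}`, `S₁ = {s₁}`, `T₀ = {t₀, t₀+e₀}`,
`T₁ = {t₁, t₁+e₁}` and a non-zero `w ∈ 𝔽₂³` orthogonal to `Ψe₀`, `Ψe₁` and `Ψ((t₁−t₀)−(s₁−s₀))` cannot exist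
(`no_dicyclic_law_of_two_small_first_second` with `φ = ⟨w, Ψ·⟩`). [folklore] -/
theorem n1_restrict_aux
    (hρρ : ∀ a b, ρ a * ρ b = ρ (a + b)) (hρτ : ∀ a b, ρ a * τ b = τ (b - a))
    (hτρ : ∀ a b, τ a * ρ b = τ (a + b)) (hττ : ∀ a b, τ a * τ b = ρ (c₀ + b - a)) (hc₀ : c₀ ≠ 0)
    (hρ : Function.Injective ρ) (hτ : Function.Injective τ) (hne : ∀ a b, ρ a ≠ τ b)
    (hsurj : ∀ g, (∃ a, ρ a = g) ∨ (∃ a, τ a = g)) (hmod : Fintype.card A % 3 = 2) (hA : 28 ≤ Fintype.card A)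
    (ψ₁ ψ₂ ψ₃ : A →+ ZMod 2) (hψc : ψ₁ c₀ = 0 ∧ ψ₂ c₀ = 0 ∧ ψ₃ c₀ = 0)
    (hψ : ∀ v : ZMod 2 × ZMod 2 × ZMod 2, ∃ x, (ψ₁ x, ψ₂ x, ψ₃ x) = v)
    {S T U : Finset G} (h : TripleProductProperty S T U)
    (hV : 3 * (S.card * T.card * U.card) + 16 = 8 * Fintype.card A)
    {s₀ s₁ t₀ t₁ e₀ e₁ : A}
    (hS₀ : (univ.filter fun a : A => ρ a ∈ S) = {s₀}) (hS₁ : (univ.filter fun a : A => τ a ∈ S) = {s₁})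
    (hT₀ : (univ.filter fun a : A => ρ a ∈ T) = {t₀, t₀ + e₀})
    (hT₁ : (univ.filter fun a : A => τ a ∈ T) = {t₁, t₁ + e₁})
    (w : ZMod 2 × ZMod 2 × ZMod 2) (hw0 : w ≠ 0)
    (hwe₀ : (w * (ψ₁.prod (ψ₂.prod ψ₃)) e₀).1 + (w * (ψ₁.prod (ψ₂.prod ψ₃)) e₀).2.1 +
      (w * (ψ₁.prod (ψ₂.prod ψ₃)) e₀).2.2 = 0)
    (hwe₁ : (w * (ψ₁.prod (ψ₂.prod ψ₃)) e₁).1 + (w * (ψ₁.prod (ψ₂.prod ψ₃)) e₁).2.1 +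
      (w * (ψ₁.prod (ψ₂.prod ψ₃)) e₁).2.2 = 0)
    (hwδ : (w * (ψ₁.prod (ψ₂.prod ψ₃)) (t₁ - t₀ - (s₁ - s₀))).1 +
      (w * (ψ₁.prod (ψ₂.prod ψ₃)) (t₁ - t₀ - (s₁ - s₀))).2.1 +
      (w * (ψ₁.prod (ψ₂.prod ψ₃)) (t₁ - t₀ - (s₁ - s₀))).2.2 = 0) : False := by
  set Ψ : A →+ ZMod 2 × ZMod 2 × ZMod 2 := ψ₁.prod (ψ₂.prod ψ₃) with hΨdef
  have hΨ : ∀ a, Ψ a = (ψ₁ a, ψ₂ a, ψ₃ a) := fun a => rfl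
  have hΨc : Ψ c₀ = 0 := by rw [hΨ, hψc.1, hψc.2.1, hψc.2.2]; rfl
  have hΨsurj : Function.Surjective Ψ := fun v => by
    obtain ⟨a, ha⟩ := hψ v
    exact ⟨a, by rw [hΨ]; exact ha⟩
  let σ : (ZMod 2 × ZMod 2 × ZMod 2) →+ ZMod 2 :=
    (AddMonoidHom.fst (ZMod 2) (ZMod 2 × ZMod 2)) + (AddMonoidHom.fst (ZMod 2) (ZMod 2)).comp
      (AddMonoidHom.snd (ZMod 2) (ZMod 2 × ZMod 2)) + (AddMonoidHom.snd (ZMod 2) (ZMod 2)).comp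
      (AddMonoidHom.snd (ZMod 2) (ZMod 2 × ZMod 2))
  let ω : (ZMod 2 × ZMod 2 × ZMod 2) →+ ZMod 2 := σ.comp (AddMonoidHom.mulLeft w)
  have hωv : ∀ v, ω v = (w * v).1 + (w * v).2.1 + (w * v).2.2 := fun v => rfl
  set φ : A →+ ZMod 2 := ω.comp Ψ with hφdef
  have hφa : ∀ a, φ a = ω (Ψ a) := fun a => rfl
  have hφc : φ c₀ = 0 := by rw [hφa, hΨc, map_zero]
  have hφ : ∃ a, φ a ≠ 0 := by
    obtain ⟨z, hz⟩ := f2cube_exists_pair_one' w hw0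
    obtain ⟨a, ha⟩ := hΨsurj z
    exact ⟨a, by rw [hφa, ha, hωv]; exact hz⟩
  have hφe₀ : φ e₀ = 0 := by rw [hφa, hωv]; exact hwe₀
  have hφe₁ : φ e₁ = 0 := by rw [hφa, hωv]; exact hwe₁
  have hφδ : φ (t₁ - t₀ - (s₁ - s₀)) = 0 := by rw [hφa, hωv]; exact hwδ
  refine no_dicyclic_law_of_two_small_first_second hρρ hρτ hτρ hττ hc₀ hρ hτ hne hsurj hmod hA ψ₁ ψ₂ ψ₃ hψc hψ h hV
    φ hφc hφ (s₁ - s₀) (φ s₀) (φ t₀) ?_ ?_ ?_ ?_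
  · intro a ha
    have : a ∈ (univ.filter fun a : A => ρ a ∈ S) := mem_filter.2 ⟨mem_univ _, ha⟩
    rw [hS₀, mem_singleton] at this; rw [this]
  · intro a ha
    have : a ∈ (univ.filter fun a : A => τ a ∈ S) := mem_filter.2 ⟨mem_univ _, ha⟩
    rw [hS₁, mem_singleton] at this
    rw [this, map_sub]; abel
  · intro a ha
    have : a ∈ (univ.filter fun a : A => ρ a ∈ T) := mem_filter.2 ⟨mem_univ _, ha⟩
    rw [hT₀, mem_insert, mem_singleton] at this
    rcases this with ha' | ha'
    · rw [ha']
    · rw [ha', map_add, hφe₀, add_zero]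
  · intro a ha
    have : a ∈ (univ.filter fun a : A => τ a ∈ T) := mem_filter.2 ⟨mem_univ _, ha⟩
    rw [hT₁, mem_insert, mem_singleton] at this
    have e1 : φ t₁ = φ t₀ + φ (s₁ - s₀) + φ (t₁ - t₀ - (s₁ - s₀)) := by simp only [map_sub]; abel
    rcases this with ha' | ha'
    · rw [ha', e1, hφδ, add_zero]
    · rw [ha', map_add, hφe₁, add_zero, e1, hφδ, add_zero]

/-- **The exact case, any quotient of `2`-rank `≥ 3`** (see the module docstring): dicyclic type, `|A| ≡ 2 (mod 3)`,
`|A| ≥ 28`, `A/⟨c₀⟩ ↠ 𝔽₂³`, `π : A →+ B` onto with kernel `{0,c₀}`; a TPP triple attaining the dicyclic law with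
`|S₀| = |S₁| = 1`, `|T₀| = |T₁| = 2`, `|U₀| = |U₁| + 2` and `4|U₀| + 2|U₁| = |A|` does not exist. [folklore] -/
theorem n1_false_of_exact_general
    (hρρ : ∀ a b, ρ a * ρ b = ρ (a + b)) (hρτ : ∀ a b, ρ a * τ b = τ (b - a))
    (hτρ : ∀ a b, τ a * ρ b = τ (a + b)) (hττ : ∀ a b, τ a * τ b = ρ (c₀ + b - a)) (hc₀ : c₀ ≠ 0)
    (hρ : Function.Injective ρ) (hτ : Function.Injective τ) (hne : ∀ a b, ρ a ≠ τ b)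
    (hsurj : ∀ g, (∃ a, ρ a = g) ∨ (∃ a, τ a = g)) (hmod : Fintype.card A % 3 = 2) (hA : 28 ≤ Fintype.card A)
    (ψ₁ ψ₂ ψ₃ : A →+ ZMod 2) (hψc : ψ₁ c₀ = 0 ∧ ψ₂ c₀ = 0 ∧ ψ₃ c₀ = 0)
    (hψ : ∀ v : ZMod 2 × ZMod 2 × ZMod 2, ∃ x, (ψ₁ x, ψ₂ x, ψ₃ x) = v)
    (π : A →+ B) (hπ : Function.Surjective π) (hker : ∀ a : A, π a = 0 ↔ a = 0 ∨ a = c₀)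
    {S T U : Finset G} (h : TripleProductProperty S T U)
    (hV : 3 * (S.card * T.card * U.card) + 16 = 8 * Fintype.card A)
    (hs₀ : (univ.filter fun a : A => ρ a ∈ S).card = 1) (hs₁ : (univ.filter fun a : A => τ a ∈ S).card = 1)
    (ht₀ : (univ.filter fun a : A => ρ a ∈ T).card = 2) (ht₁ : (univ.filter fun a : A => τ a ∈ T).card = 2)
    (hcard : (univ.filter fun a : A => ρ a ∈ U).card = (univ.filter fun a : A => τ a ∈ U).card + 2)
    (hex : 4 * (univ.filter fun a : A => ρ a ∈ U).card + 2 * (univ.filter fun a : A => τ a ∈ U).card =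
      Fintype.card A) : False := by
  classical
  obtain ⟨s₀, hS₀⟩ := card_eq_one.1 hs₀
  obtain ⟨s₁, hS₁⟩ := card_eq_one.1 hs₁
  obtain ⟨t₀, t₀', htt₀, hT₀'⟩ := card_eq_two.1 ht₀
  obtain ⟨t₁, t₁', htt₁, hT₁'⟩ := card_eq_two.1 ht₁
  have hT₀ : (univ.filter fun a : A => ρ a ∈ T) = {t₀, t₀ + (t₀' - t₀)} := by rw [add_sub_cancel]; exact hT₀'
  have hT₁ : (univ.filter fun a : A => τ a ∈ T) = {t₁, t₁ + (t₁' - t₁)} := by rw [add_sub_cancel]; exact hT₁'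
  have he₀ : t₀' - t₀ ≠ 0 := sub_ne_zero.2 htt₀.symm
  have he₁ : t₁' - t₁ ≠ 0 := sub_ne_zero.2 htt₁.symm
  set e₀ := t₀' - t₀ with he₀d
  set e₁ := t₁' - t₁ with he₁d
  let Ψ : A →+ ZMod 2 × ZMod 2 × ZMod 2 := ψ₁.prod (ψ₂.prod ψ₃)
  have hΨ : ∀ a, Ψ a = (ψ₁ a, ψ₂ a, ψ₃ a) := fun a => rfl
  have hΨc : Ψ c₀ = 0 := by rw [hΨ, hψc.1, hψc.2.1, hψc.2.2]; rfl
  let σ : (ZMod 2 × ZMod 2 × ZMod 2) →+ ZMod 2 :=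
    (AddMonoidHom.fst (ZMod 2) (ZMod 2 × ZMod 2)) + (AddMonoidHom.fst (ZMod 2) (ZMod 2)).comp
      (AddMonoidHom.snd (ZMod 2) (ZMod 2 × ZMod 2)) + (AddMonoidHom.snd (ZMod 2) (ZMod 2)).comp
      (AddMonoidHom.snd (ZMod 2) (ZMod 2 × ZMod 2))
  have hσ : ∀ w v : ZMod 2 × ZMod 2 × ZMod 2, (σ.comp (AddMonoidHom.mulLeft w)) v = (w * v).1 + (w * v).2.1 + (w * v).2.2 :=
    fun w v => rfl
  have hzmod : ∀ z : ZMod 2, z = 0 ∨ z = 1 := by decide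
  have htr0 : ∀ w : ZMod 2 × ZMod 2 × ZMod 2, (w * 0).1 + (w * 0).2.1 + (w * 0).2.2 = 0 := fun w => by
    rw [mul_zero]; rfl
  rcases f2cube_exists_both (Ψ e₀) (Ψ e₁) with hz | hz | ⟨w, hw₀, hw₁⟩
  · obtain ⟨w, hw0, hwe, hwδ⟩ := f2cube_exists_perp₂ (Ψ e₁) (Ψ (t₁ - t₀ - (s₁ - s₀)))
    have hwe₀ : (w * Ψ e₀).1 + (w * Ψ e₀).2.1 + (w * Ψ e₀).2.2 = 0 := by rw [hz]; exact htr0 w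
    exact n1_restrict_aux hρρ hρτ hτρ hττ hc₀ hρ hτ hne hsurj hmod hA ψ₁ ψ₂ ψ₃ hψc hψ h hV hS₀ hS₁ hT₀ hT₁ w hw0 hwe₀
      hwe hwδ
  · obtain ⟨w, hw0, hwe, hwδ⟩ := f2cube_exists_perp₂ (Ψ e₀) (Ψ (t₁ - t₀ - (s₁ - s₀)))
    have hwe₁ : (w * Ψ e₁).1 + (w * Ψ e₁).2.1 + (w * Ψ e₁).2.2 = 0 := by rw [hz]; exact htr0 w
    exact n1_restrict_aux hρρ hρτ hτρ hττ hc₀ hρ hτ hne hsurj hmod hA ψ₁ ψ₂ ψ₃ hψc hψ h hV hS₀ hS₁ hT₀ hT₁ w hw0 hwe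
      hwe₁ hwδ
  · -- both `Ψ e₀`, `Ψ e₁` non-zero: gen 12's chain with the real killing character
    let ω : (ZMod 2 × ZMod 2 × ZMod 2) →+ ZMod 2 := σ.comp (AddMonoidHom.mulLeft w)
    set φ : A →+ ZMod 2 := ω.comp Ψ with hφdef
    have hφa : ∀ a, φ a = (w * Ψ a).1 + (w * Ψ a).2.1 + (w * Ψ a).2.2 := fun a => rfl
    have hφe₀ : φ e₀ = 1 := by
      rcases hzmod (φ e₀) with h0 | h1
      · exact absurd (by rw [← hφa]; exact h0) hw₀
      · exact h1
    have hφe₁ : φ e₁ = 1 := by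
      rcases hzmod (φ e₁) with h0 | h1
      · exact absurd (by rw [← hφa]; exact h0) hw₁
      · exact h1
    have hle : π.ker ≤ φ.ker := by
      intro a ha
      rw [AddMonoidHom.mem_ker] at ha ⊢
      rcases (hker a).1 ha with h0 | h0
      · rw [h0]; exact map_zero φ
      · rw [h0]
        show ω (Ψ c₀) = 0
        rw [hΨc, map_zero]
    let φbar : B →+ ZMod 2 := π.liftOfSurjective hπ ⟨φ, hle⟩
    have hφbar : ∀ a, φbar (π a) = φ a := fun a => π.liftOfRightInverse_comp_apply _ _ ⟨φ, hle⟩ a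
    have hζ : (-1 : ℂ) ^ 2 = 1 := by norm_num
    let χ : AddChar B ℂ := (AddChar.zmodChar 2 hζ).compAddMonoidHom φbar
    have hχ : ∀ b, χ b = (-1 : ℂ) ^ (φbar b).val := fun b => rfl
    have hkill : ∀ ι : B, (ι = π e₁ - π e₀ ∨ ι = π e₁ + π e₀) → ι + ι = 0 → π e₁ ≠ ι →
        ∃ χ : AddChar B ℂ, χ ι = 1 ∧ χ (π e₁) = -1 := by
      intro ι hι _ _
      refine ⟨χ, ?_, ?_⟩
      · have h0 : φbar ι = 0 := by
          rcases hι with rfl | rfl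
          · rw [map_sub, hφbar, hφbar, hφe₀, hφe₁, sub_self]
          · rw [map_add, hφbar, hφbar, hφe₀, hφe₁]; decide
        rw [hχ, h0, ZMod.val_zero, pow_zero]
      · rw [hχ, hφbar, hφe₁]
        show (-1 : ℂ) ^ (1 : ZMod 2).val = -1
        have : (1 : ZMod 2).val = 1 := rfl
        rw [this, pow_one]
    -- data of the triple itself (vertex `000`)
    obtain ⟨⟨f₀₀, f₀₁, f₁₀, f₁₁⟩, ⟨h12, h13, h23⟩, ⟨p₀₀, p₀₁, p₁₀⟩, hsub⟩ :=
      n1_vertex_data hρρ hρτ hτρ hττ hρ hτ hne h hS₀ hS₁ hT₀ hT₁ he₀ he₁ hex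
    -- the `T·τ0`-translate (vertex `010`)
    have er : (Equiv.mulRight (1 : G)).toEmbedding = Function.Embedding.refl G := by ext x; simp
    have h' : TripleProductProperty S (T.map (Equiv.mulRight (τ 0)).toEmbedding) U := by
      have := h.map_mulRight 1 (τ 0) 1; simpa only [er, Finset.map_refl] using this
    have hT'₀ : (univ.filter fun a : A => ρ a ∈ T.map (Equiv.mulRight (τ 0)).toEmbedding) =
        {-c₀ - (t₁ + e₁), -c₀ - (t₁ + e₁) + e₁} := by
      rw [rho_part_mulRight_tau hρρ hρτ hττ T, hT₁, image_insert, image_singleton,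
        show -c₀ - t₁ = -c₀ - (t₁ + e₁) + e₁ by abel, pair_comm]
    have hT'₁ : (univ.filter fun a : A => τ a ∈ T.map (Equiv.mulRight (τ 0)).toEmbedding) =
        {-(t₀ + e₀), -(t₀ + e₀) + e₀} := by
      rw [tau_part_mulRight_tau hρρ hττ T, hT₀, image_insert, image_singleton,
        show -t₀ = -(t₀ + e₀) + e₀ by abel, pair_comm]
    obtain ⟨-, ⟨k12, k13, k23⟩, ⟨-, p₁₁, -⟩, -⟩ :=
      n1_vertex_data hρρ hρτ hτρ hττ hρ hτ hne h' hS₀ hS₁ hT'₀ hT'₁ he₁ he₀ hex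
    obtain ⟨g, z, hcov⟩ := n1_four_cosets' π hπ hker hc₀ f₀₀ f₀₁ f₁₀ f₁₁ hcard hex.symm h12 h13 h23 k12 k13 k23
      (by abel) (by abel) rfl p₀₀ p₀₁ p₁₀ p₁₁ hsub hkill
    exact psi_not_onto_of_four_cosets ψ₁ ψ₂ ψ₃ hψc hcov hψ

/-- **No N1-class dicyclic-law triple for ANY `A/⟨c₀⟩` of `2`-rank `≥ 3`** (see the module docstring).  (Reduction to the
exact case as in gen 12's `no_n1_dicyclic_law`: `|U₀| = |U₁| ± 2`, and a `τ0`-translation of `U`.) [folklore] -/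
theorem no_n1_dicyclic_law_general
    (hρρ : ∀ a b, ρ a * ρ b = ρ (a + b)) (hρτ : ∀ a b, ρ a * τ b = τ (b - a))
    (hτρ : ∀ a b, τ a * ρ b = τ (a + b)) (hττ : ∀ a b, τ a * τ b = ρ (c₀ + b - a)) (hc₀ : c₀ ≠ 0)
    (hρ : Function.Injective ρ) (hτ : Function.Injective τ) (hne : ∀ a b, ρ a ≠ τ b)
    (hsurj : ∀ g, (∃ a, ρ a = g) ∨ (∃ a, τ a = g)) (hmod : Fintype.card A % 3 = 2) (hA : 28 ≤ Fintype.card A)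
    (ψ₁ ψ₂ ψ₃ : A →+ ZMod 2) (hψc : ψ₁ c₀ = 0 ∧ ψ₂ c₀ = 0 ∧ ψ₃ c₀ = 0)
    (hψ : ∀ v : ZMod 2 × ZMod 2 × ZMod 2, ∃ x, (ψ₁ x, ψ₂ x, ψ₃ x) = v)
    (π : A →+ B) (hπ : Function.Surjective π) (hker : ∀ a : A, π a = 0 ↔ a = 0 ∨ a = c₀)
    {S T U : Finset G} (h : TripleProductProperty S T U)
    (hs₀ : (univ.filter fun a : A => ρ a ∈ S).card = 1) (hs₁ : (univ.filter fun a : A => τ a ∈ S).card = 1)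
    (ht₀ : (univ.filter fun a : A => ρ a ∈ T).card = 2) (ht₁ : (univ.filter fun a : A => τ a ∈ T).card = 2)
    (hU : (univ.filter fun a : A => ρ a ∈ U).card ≠ (univ.filter fun a : A => τ a ∈ U).card) :
    3 * (S.card * T.card * U.card) + 16 ≠ 8 * Fintype.card A := by
  intro hV
  have cS : S.card = 2 := by rw [card_eq_parts' hρ hτ hne hsurj S, hs₀, hs₁]
  have cT : T.card = 4 := by rw [card_eq_parts' hρ hτ hne hsurj T, ht₀, ht₁]
  have cU := card_eq_parts' hρ hτ hne hsurj U
  have h8 : 8 ∣ Fintype.card A := eight_dvd_card_of_onto ψ₁ ψ₂ ψ₃ hψ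
  obtain ⟨h000, h111, -⟩ := vertex_counting' hρρ hρτ hτρ hττ hρ hτ hne h
  rw [hs₀, hs₁, ht₀, ht₁] at h000 h111
  have hV' := hV
  rw [cS, cT, cU] at hV'
  set u₀ := (univ.filter fun a : A => ρ a ∈ U).card with hu₀
  set u₁ := (univ.filter fun a : A => τ a ∈ U).card with hu₁
  obtain ⟨q, hq⟩ := h8
  by_cases hcase : u₀ = u₁ + 2
  · exact n1_false_of_exact_general hρρ hρτ hτρ hττ hc₀ hρ hτ hne hsurj hmod hA ψ₁ ψ₂ ψ₃ hψc hψ π hπ hker h hV hs₀ hs₁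
      ht₀ ht₁ hcase (by omega)
  · have hcase' : u₁ = u₀ + 2 := by omega
    have er : (Equiv.mulRight (1 : G)).toEmbedding = Function.Embedding.refl G := by ext x; simp
    have h' : TripleProductProperty S T (U.map (Equiv.mulRight (τ 0)).toEmbedding) := by
      have := h.map_mulRight 1 1 (τ 0); simpa only [er, Finset.map_refl] using this
    have cU'₀ := card_rho_part_mulRight_tau hρρ hρτ hττ (A := A) U
    have cU'₁ := card_tau_part_mulRight_tau hρρ hττ (A := A) U
    have hVmap : 3 * (S.card * T.card * (U.map (Equiv.mulRight (τ 0)).toEmbedding).card) + 16 =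
        8 * Fintype.card A := by rw [card_map]; exact hV
    exact n1_false_of_exact_general hρρ hρτ hτρ hττ hc₀ hρ hτ hne hsurj hmod hA ψ₁ ψ₂ ψ₃ hψc hψ π hπ hker h' hVmap
      hs₀ hs₁ ht₀ ht₁ (by rw [cU'₀, cU'₁]; omega) (by rw [cU'₀, cU'₁]; omega)

end N1

end Summit.MatrixMultiplication.OmegaCensus
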